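import Literature.AlgebraicGeometry.Motives.HodgeStructureExteriorAlgebraCorrespondences
import Literature.AlgebraicGeometry.Motives.HodgeStructureProdPolarizationLefschetzClass
import Literature.AlgebraicGeometry.Motives.HodgeStructureLefschetzGroupDirectSumPoints
import Literature.AlgebraicGeometry.Motives.HodgeStructureHodgeStarLefschetzGroup
import HarnessLib

/-!
# Milne 1999, Prop. 5.7 AS PRINTED on the polarized-`ℚ`-Hodge-structure carrier: a correspondence `u ∈ H•(A × B) = ⋀(V₁ ⊕ V₂)` is
# Lefschetz iff `ū` commutes with the actions of `L(A × B)`; and then `ū` maps Lefschetz classes of `A` to Lefschetz classes of `B`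

[topic AlgebraicGeometry/Motives]

Layer `Literature/AlgebraicGeometry/Motives`, lane `lit-hodgefound` (Track 2 foundations library; prover seat `lit-hodgefound-p34`,
generation 32, row g32-#3). THEOREMS ONLY (no `def`, no named fact, no instance, no notation; net debt `0`). Sequel of rows g32-#1/#2
(`Motives/HodgeStructureExteriorAlgebraKunnethGysin`, `Motives/HodgeStructureExteriorAlgebraCorrespondences`: `Φ = kunnethEquiv`,
`q_* = gysinSnd`, Milne's dictionary `corrMap ω₁ g₁ : u ↦ ū = q_* ∘ (· ∪ u) ∘ p^*`, bijective (`IsSymplectic.corrEquiv`), and the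
mechanism `⋀(f₁ × f₂) u = u ⟺ ⋀f₂ ∘ ū = ū ∘ ⋀f₁`), now read on the CARRIER of the `S(H)(ℂ)`-invariant theory of the tree: two
polarized `ℚ`-Hodge structures `(Hᵢ, Qᵢ)` of the same odd weight `n` on `Vᵢ` (`dim Vᵢ = 2gᵢ`), `H₁ ⊕ H₂` with the product polarization
`Q₁.prod Q₂`, the Lefschetz classes `Eᵢ = E_{Qᵢ}`, `E_{Q₁ ⊕ Q₂} = ⋀(inl)E₁ + ⋀(inr)E₂` (row g31-#10), the complexification
`Θ = toComplexAlg`, the Lefschetz groups `S(Hᵢ)(ℂ) = Qᵢ.lefschetzGroupBaseChange ℂ`, `S(H₁ ⊕ H₂)(ℂ)` whose elements are the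
block-diagonal `γ₁ ⊕ γ₂` subject to Milne's intertwining conditions (rows g18-#5: `blockDiag_mem_lefschetzGroupBaseChange_prod_iff`,
`lefschetzGroupBaseChange_prod_le_map_blockDiag`) — this is `L(A × B)` acting on `H•(A)` through `γ₁` and on `H•(B)` through `γ₂` — and
THE TREE'S THM. 3.2 / COR. 4.5: the `ℚ`-algebra `ℚ[B¹(H)]` of Lefschetz (= divisor-generated) classes is EXACTLY the set of rational
classes with `S(H)(ℂ)`-invariant complexification (`Polarization.setOf_forall_lefschetzGroupBaseChange_map_toComplexAlg_eq_eq_adjoin_hodgeClasses_two`).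

## Source, VERBATIM

J. S. Milne, *Lefschetz classes on abelian varieties*, Duke Math. J. **96** (1999) [Milne1999LefschetzClasses] (held text
`paper:doi-10-1215-s0012-7094-99-09620-5`, p0026 = p. 664): "A cohomological correspondence `u ∈ H^*(X × Y)` is said to be Lefschetz
if it lies in the subalgebra `D_hom(X × Y)_k` of `H^*(X × Y)`. PROPOSITION 5.7. Let `A` and `B` be abelian varieties over `Ω`. A
cohomological correspondence `u` between `A` and `B` is Lefschetz if and only if `ū : H^*(A) → H^*(B)` commutes with the actions of
`L(A × B)`. If `u` is Lefschetz, then `ū` maps `D(A)_k` into `D(B)_k`. *Proof.* The map `u ↦ ū` is bijective and commutes with the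
action of `L(A × B)`, whence the first statement. The maps `φ_*`, `φ^*`, and cupping with a Lefschetz class, all preserve Lefschetz
classes, whence the second statement."; p. 663: "`L(A)` is canonically a quotient `L → L(A)` of `L`, and so there is a natural action
of `L` on `V(A)`"; §4 Cor. 4.5 (p. 659): "`H^{2*}(A^r)(*)^{L(A)} = D_hom(A^r)_k`"; §1 Prop. 1.5 and Remark 1.6 (p. 644), §3 p. 654
("`S(A) = S(A^r)`").

## What is PROVED (`β = TensorProduct.prodRight ℚ ℂ ℂ V₁ V₂ : ℂ ⊗ (V₁ × V₂) ≃ V₁,ℂ × V₂,ℂ`, `ū_ℂ := (⋀β Θ u)~` for the genus `g₁`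
## and the complexified class `Θ E₁`; `ℚ[B¹(H)] = Algebra.adjoin ℚ (Hdg(⋀²H))`)

* §1 PLUMBING `ℚ → ℂ` on `V₁ × V₂`: `prodRight_comp_blockDiag` / `map_prodRight_map_blockDiag` (`⋀β ∘ ⋀(γ₁ ⊕ γ₂) = ⋀(γ₁ × γ₂) ∘ ⋀β`),
  `map_prodRight_toComplexAlg_map_inl` / `_inr` (`⋀β Θ p^* = p^*_ℂ Θ`, `⋀β Θ q^* = q^*_ℂ Θ`), `map_prodRight_toComplexAlg_kunnethEquiv_tmul`
  (`⋀β Θ Φ(a ⊗ b) = Φ_ℂ(Θa ⊗ Θb)`), **`span_range_toComplexAlg`** (`⋀_ℂ V_ℂ` is spanned over `ℂ` by `Θ(⋀_ℚ V)`) and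
  `linearMap_ext_of_toComplexAlg`, `IsSymplectic.trace_toComplexAlg_apply` (`τ_{ΘE}(Θ z) = τ_E(z)` in ALL degrees).
* §2 **THE DICTIONARY COMMUTES WITH `Θ`: `IsSymplectic.corrMap_map_prodRight_toComplexAlg_apply` (`ū_ℂ (Θ x) = Θ (ū x)`)** and on
  classes **`IsSymplectic.map_prodRight_toComplexAlg_corrEquiv_symm`: `⋀β Θ [T] = [T_ℂ]`** whenever `T_ℂ Θ = Θ T`.
* §3 `Polarization.mem_adjoin_hodgeClasses_two_iff_forall_map_toComplexAlg_eq` (membership form of the tree's Thm. 3.2 / Cor. 4.5);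
  **PROP. 5.7, FIRST STATEMENT, AS PRINTED — `Polarization.mem_adjoin_hodgeClasses_two_prod_iff_forall_blockDiag`: `u ∈ ℚ[B¹(H₁ ⊕ H₂)]`
  iff for every `γ₁ ⊕ γ₂ ∈ S(H₁ ⊕ H₂)(ℂ)`, `⋀γ₂ ∘ ū_ℂ = ū_ℂ ∘ ⋀γ₁`** ("ū commutes with the actions of `L(A × B)`"); for operators,
  **`Polarization.corrEquiv_symm_mem_adjoin_hodgeClasses_two_prod_iff`: `[T] ∈ ℚ[B¹(H₁ ⊕ H₂)]` iff `⋀γ₂ ∘ T_ℂ = T_ℂ ∘ ⋀γ₁` for all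
  `γ₁ ⊕ γ₂ ∈ S(H₁ ⊕ H₂)(ℂ)`**; the case `A = B` through "`S(A × A) = ΔS(A)`":
  **`Polarization.mem_adjoin_hodgeClasses_two_prod_self_iff_forall`**, **`Polarization.corrEquiv_symm_mem_adjoin_hodgeClasses_two_prod_self_iff`**
  (`[T] ∈ ℚ[B¹(H ⊕ H)]` iff `T_ℂ` commutes with `⋀γ` for every `γ ∈ S(H)(ℂ)`).
* §4 **PROP. 5.7, SECOND STATEMENT — `Polarization.corrMap_apply_mem_adjoin_hodgeClasses_two`: if `u ∈ ℚ[B¹(H₁ ⊕ H₂)]` then `ū` maps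
  `ℚ[B¹(H₁)]` into `ℚ[B¹(H₂)]`**, under the hypothesis that `S(H₁ ⊕ H₂)(ℂ) → S(H₂)(ℂ)` is onto ("`L(B)` is a quotient of `L`"), which
  is discharged for `A = B` (`…_of_prod_self`: `γ ⊕ γ`) and for Hom-orthogonal pairs (`…_of_hom_eq_zero`: `1 ⊕ γ₂`, Prop. 1.5).

TWIN NOTICE (RULING 29 bis): the torus-forms carrier has Prop. 5.7 / Thm. 5.9 in p08's `Geometry/Kaehler/ComplexTorusLefschetzAlgebraCorrespondences{,AnyBasis}`
(`corrMapT`, `corrClass`, `exists_mem_divisorClasses_corrMapT_iff…`); nothing of it is imported or restated here (Motives does not import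
Kaehler); the present statements are about ABSTRACT polarized `ℚ`-Hodge structures of any odd weight and Milne's `S(H)(ℂ)`-invariants.

## References

* [Milne1999LefschetzClasses] J. S. Milne, *Lefschetz classes on abelian varieties*, Duke Math. J. 96 (1999), §5 Prop. 5.7 (p. 664),
  p. 663, §4 Cor. 4.5 (p. 659), §3 Thm. 3.2 (p. 653), §1 Prop. 1.5 / Remark 1.6 (p. 644).
* [VoisinHodgeI2002] C. Voisin, *Hodge Theory and Complex Algebraic Geometry I* (2002), §11.3.3 Lemma 11.41 and (11.11).
* [BourbakiAlgebraI1989] N. Bourbaki, *Algebra I, Chapters 1–3* (1989), Ch. III §7 no. 5 Prop. 8 (extension of scalars of `⋀`), no. 7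
  Prop. 10.
-/

noncomputable section

open scoped TensorProduct

namespace Literature.AlgebraicGeometry.Motives

universe u

/-! ## §1 Plumbing `ℚ → ℂ` on `V₁ × V₂`: `β = prodRight`, block-diagonal automorphisms, `Θ` on `p^*`, `q^*`, `Φ`; `Θ(⋀_ℚ V)` spans `⋀_ℂ V_ℂ` -/

namespace ExteriorLefschetz

open Literature.Algebra.Lie ExteriorAlgebra

variable {V₁ V₂ : Type u} [AddCommGroup V₁] [Module ℚ V₁] [AddCommGroup V₂] [Module ℚ V₂]

/-- `β ∘ (γ₁ ⊕ γ₂) = (γ₁ × γ₂) ∘ β` for `β = prodRight : ℂ ⊗ (V₁ × V₂) ≃ V₁,ℂ × V₂,ℂ` (the tree's `blockDiag` is `β⁻¹ (γ₁ × γ₂) β` by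
definition). [cite: Milne1999LefschetzClasses, §1 Prop. 1.5 and Remark 1.6 (p. 644)] [cite: Moonen2004MT, §4 Lemma 4.6] -/
theorem prodRight_comp_blockDiag (γ₁ : (ℂ ⊗[ℚ] V₁) ≃ₗ[ℂ] (ℂ ⊗[ℚ] V₁)) (γ₂ : (ℂ ⊗[ℚ] V₂) ≃ₗ[ℂ] (ℂ ⊗[ℚ] V₂)) :
    (TensorProduct.prodRight ℚ ℂ ℂ V₁ V₂).toLinearMap ∘ₗ (blockDiag ℂ V₁ V₂ (γ₁, γ₂) : ℂ ⊗[ℚ] (V₁ × V₂) →ₗ[ℂ] ℂ ⊗[ℚ] (V₁ × V₂)) =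
      ((γ₁ : ℂ ⊗[ℚ] V₁ →ₗ[ℂ] ℂ ⊗[ℚ] V₁).prodMap (γ₂ : ℂ ⊗[ℚ] V₂ →ₗ[ℂ] ℂ ⊗[ℚ] V₂)) ∘ₗ
        (TensorProduct.prodRight ℚ ℂ ℂ V₁ V₂).toLinearMap := by
  refine LinearMap.ext fun x ↦ ?_
  change TensorProduct.prodRight ℚ ℂ ℂ V₁ V₂ ((TensorProduct.prodRight ℚ ℂ ℂ V₁ V₂).symm
    ((γ₁.prodCongr γ₂) (TensorProduct.prodRight ℚ ℂ ℂ V₁ V₂ x))) = _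
  rw [LinearEquiv.apply_symm_apply]
  rfl

/-- **`⋀β (⋀(γ₁ ⊕ γ₂) X) = ⋀(γ₁ × γ₂) (⋀β X)`** on `⋀_ℂ(ℂ ⊗ (V₁ × V₂))`. [cite: Milne1999LefschetzClasses, §1 Prop. 1.5 and Remark 1.6 (p. 644)]
[cite: BourbakiAlgebraI1989, Ch. III §7 no. 2 (functoriality)] -/
theorem map_prodRight_map_blockDiag (γ₁ : (ℂ ⊗[ℚ] V₁) ≃ₗ[ℂ] (ℂ ⊗[ℚ] V₁)) (γ₂ : (ℂ ⊗[ℚ] V₂) ≃ₗ[ℂ] (ℂ ⊗[ℚ] V₂))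
    (X : ExteriorAlgebra ℂ (ℂ ⊗[ℚ] (V₁ × V₂))) :
    ExteriorAlgebra.map (TensorProduct.prodRight ℚ ℂ ℂ V₁ V₂).toLinearMap
        (ExteriorAlgebra.map (blockDiag ℂ V₁ V₂ (γ₁, γ₂) : ℂ ⊗[ℚ] (V₁ × V₂) →ₗ[ℂ] ℂ ⊗[ℚ] (V₁ × V₂)) X) =
      ExteriorAlgebra.map ((γ₁ : ℂ ⊗[ℚ] V₁ →ₗ[ℂ] ℂ ⊗[ℚ] V₁).prodMap (γ₂ : ℂ ⊗[ℚ] V₂ →ₗ[ℂ] ℂ ⊗[ℚ] V₂))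
        (ExteriorAlgebra.map (TensorProduct.prodRight ℚ ℂ ℂ V₁ V₂).toLinearMap X) := by
  rw [← AlgHom.comp_apply, map_comp_map, prodRight_comp_blockDiag, ← map_comp_map, AlgHom.comp_apply]

/-- **`⋀β (Θ (p^* x)) = p^*_ℂ (Θ x)`**: `⋀β ∘ Θ_{V₁⊕V₂} ∘ ⋀(inl) = ⋀(inl_ℂ) ∘ Θ_{V₁}` (`ℚ`-algebra maps agreeing on `ι(v)`:
`β(1 ⊗ (v, 0)) = (1 ⊗ v, 0)`). [cite: BourbakiAlgebraI1989, Ch. III §7 no. 5 Prop. 8 (extension of scalars)] -/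
theorem map_prodRight_toComplexAlg_map_inl (x : ExteriorAlgebra ℚ V₁) :
    ExteriorAlgebra.map (TensorProduct.prodRight ℚ ℂ ℂ V₁ V₂).toLinearMap
        (toComplexAlg (V₁ × V₂) (ExteriorAlgebra.map (LinearMap.inl ℚ V₁ V₂) x)) =
      ExteriorAlgebra.map (LinearMap.inl ℂ (ℂ ⊗[ℚ] V₁) (ℂ ⊗[ℚ] V₂)) (toComplexAlg V₁ x) := by
  induction x using ExteriorAlgebra.induction with
  | algebraMap r =>
    simp only [Algebra.algebraMap_eq_smul_one, AlgHom.map_smul_of_tower, map_one]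
  | ι v =>
    simp only [map_apply_ι, LinearMap.inl_apply, toComplexAlg_ι, LinearEquiv.coe_coe, TensorProduct.prodRight_tmul,
      TensorProduct.tmul_zero]
  | mul a b ha hb => simp only [map_mul, ha, hb]
  | add a b ha hb => simp only [map_add, ha, hb]

/-- **`⋀β (Θ (q^* y)) = q^*_ℂ (Θ y)`.** [cite: BourbakiAlgebraI1989, Ch. III §7 no. 5 Prop. 8] -/
theorem map_prodRight_toComplexAlg_map_inr (y : ExteriorAlgebra ℚ V₂) :
    ExteriorAlgebra.map (TensorProduct.prodRight ℚ ℂ ℂ V₁ V₂).toLinearMap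
        (toComplexAlg (V₁ × V₂) (ExteriorAlgebra.map (LinearMap.inr ℚ V₁ V₂) y)) =
      ExteriorAlgebra.map (LinearMap.inr ℂ (ℂ ⊗[ℚ] V₁) (ℂ ⊗[ℚ] V₂)) (toComplexAlg V₂ y) := by
  induction y using ExteriorAlgebra.induction with
  | algebraMap r =>
    simp only [Algebra.algebraMap_eq_smul_one, AlgHom.map_smul_of_tower, map_one]
  | ι v =>
    simp only [map_apply_ι, LinearMap.inr_apply, toComplexAlg_ι, LinearEquiv.coe_coe, TensorProduct.prodRight_tmul,
      TensorProduct.tmul_zero]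
  | mul a b ha hb => simp only [map_mul, ha, hb]
  | add a b ha hb => simp only [map_add, ha, hb]

/-- **`⋀β (Θ (Φ(a ⊗ b))) = Φ_ℂ(Θa ⊗ Θb)`**: the Künneth map commutes with extension of scalars.
[cite: BourbakiAlgebraI1989, Ch. III §7 no. 5 Prop. 8 and no. 7 Prop. 10] -/
theorem map_prodRight_toComplexAlg_kunnethEquiv_tmul (a : ExteriorAlgebra ℚ V₁) (b : ExteriorAlgebra ℚ V₂) :
    ExteriorAlgebra.map (TensorProduct.prodRight ℚ ℂ ℂ V₁ V₂).toLinearMap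
        (toComplexAlg (V₁ × V₂) (kunnethEquiv ℚ V₁ V₂ (a ⊗ₜ[ℚ] b))) =
      kunnethEquiv ℂ (ℂ ⊗[ℚ] V₁) (ℂ ⊗[ℚ] V₂) (toComplexAlg V₁ a ⊗ₜ[ℂ] toComplexAlg V₂ b) := by
  rw [kunnethEquiv_tmul, map_mul, map_mul, map_prodRight_toComplexAlg_map_inl, map_prodRight_toComplexAlg_map_inr, kunnethEquiv_tmul]

/-- **`Θ(⋀_ℚ V)` spans `⋀_ℂ V_ℂ` over `ℂ`** (`ι(c ⊗ v) = c · Θ(ι v)`, and products of elements of the image are in the image).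
[cite: BourbakiAlgebraI1989, Ch. III §7 no. 5 Prop. 8 ("ℂ ⊗ ⋀(V) ≅ ⋀(ℂ ⊗ V)")] -/
theorem span_range_toComplexAlg (V : Type u) [AddCommGroup V] [Module ℚ V] :
    Submodule.span ℂ (Set.range (toComplexAlg V)) = ⊤ := by
  refine Submodule.eq_top_iff'.2 fun X ↦ ?_
  induction X using ExteriorAlgebra.induction with
  | algebraMap c =>
    rw [Algebra.algebraMap_eq_smul_one]
    exact Submodule.smul_mem _ c (Submodule.subset_span ⟨1, map_one _⟩)
  | ι w =>
    induction w using TensorProduct.induction_on with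
    | zero => rw [map_zero]; exact zero_mem _
    | add w w' hw hw' => rw [map_add]; exact add_mem hw hw'
    | tmul c v =>
      rw [show c ⊗ₜ[ℚ] v = c • ((1 : ℂ) ⊗ₜ[ℚ] v) by rw [TensorProduct.smul_tmul', smul_eq_mul, mul_one], map_smul,
        ← toComplexAlg_ι]
      exact Submodule.smul_mem _ c (Submodule.subset_span ⟨ι ℚ v, rfl⟩)
  | mul a b ha hb =>
    have h := Submodule.mul_mem_mul ha hb
    rw [Submodule.span_mul_span] at h
    refine Submodule.span_mono ?_ h
    rintro _ ⟨_, ⟨x, rfl⟩, _, ⟨y, rfl⟩, rfl⟩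
    exact ⟨x * y, map_mul _ x y⟩
  | add a b ha hb => exact add_mem ha hb

/-- **Two `ℂ`-linear maps out of `⋀_ℂ V_ℂ` that agree on `Θ(⋀_ℚ V)` are equal.** [cite: BourbakiAlgebraI1989, Ch. III §7 no. 5 Prop. 8] -/
theorem linearMap_ext_of_toComplexAlg {V : Type u} [AddCommGroup V] [Module ℚ V] {M : Type*} [AddCommGroup M] [Module ℂ M]
    {f g : ExteriorAlgebra ℂ (ℂ ⊗[ℚ] V) →ₗ[ℂ] M} (h : ∀ x, f (toComplexAlg V x) = g (toComplexAlg V x)) : f = g :=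
  LinearMap.ext_on_range (span_range_toComplexAlg V) h

/-- **The trace commutes with `Θ` in every degree: `τ_{ΘE}(Θ z) = τ_E(z)`** (top degree: the tree's `trace_toComplexAlg`; other degrees:
both vanish). [cite: Voisin2002, §6.3.2 (p. 128)] [cite: BourbakiAlgebraI1989, Ch. III §7 no. 5 Prop. 8] -/
theorem IsSymplectic.trace_toComplexAlg_apply {V : Type u} [AddCommGroup V] [Module ℚ V] {ω : ExteriorAlgebra ℚ V} {g : ℕ}
    (hω : IsSymplectic ω g) (hω' : IsSymplectic (toComplexAlg V ω) g) (z : ExteriorAlgebra ℚ V) :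
    trace (toComplexAlg V ω) g (toComplexAlg V z) = algebraMap ℚ ℂ (trace ω g z) := by
  induction z using DirectSum.Decomposition.inductionOn (fun i : ℕ ↦ ⋀[ℚ]^i V) with
  | zero => rw [map_zero, map_zero, map_zero, map_zero]
  | add z z' hz hz' => rw [map_add, map_add, hz, hz', map_add, map_add]
  | @homogeneous m z =>
    by_cases hm : m = 2 * g
    · subst hm
      exact trace_toComplexAlg hω hω' z.2
    · rw [trace_apply_of_mem_ne (toComplexAlg_mem V z.2) hm, trace_apply_of_mem_ne z.2 hm, map_zero]

/-! ## §2 The dictionary `u ↦ ū` commutes with `Θ` -/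

/-- **`ū_ℂ (Θ x) = Θ (ū x)`**: the realisation of the complexified class `⋀β Θ u` (for the complexified orientation `τ_{ΘE}`) extends the
realisation of `u` (for `τ_E`) — on `u = Φ(a ⊗ b)` both are `τ(x ∧ a) Θb`. [cite: Milne1999LefschetzClasses, §5 p. 664 (u ↦ ū for every Weil cohomology / coefficient field k)]
[cite: BourbakiAlgebraI1989, Ch. III §7 no. 5 Prop. 8] -/
theorem IsSymplectic.corrMap_map_prodRight_toComplexAlg_apply {ω : ExteriorAlgebra ℚ V₁} {g₁ : ℕ} (hω : IsSymplectic ω g₁)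
    (hω' : IsSymplectic (toComplexAlg V₁ ω) g₁) (u : ExteriorAlgebra ℚ (V₁ × V₂)) (x : ExteriorAlgebra ℚ V₁) :
    corrMap (toComplexAlg V₁ ω) g₁ (ExteriorAlgebra.map (TensorProduct.prodRight ℚ ℂ ℂ V₁ V₂).toLinearMap (toComplexAlg (V₁ × V₂) u))
        (toComplexAlg V₁ x) =
      toComplexAlg V₂ (corrMap ω g₁ u x) := by
  obtain ⟨t, rfl⟩ := (kunnethEquiv ℚ V₁ V₂).surjective u
  induction t using TensorProduct.induction_on with
  | zero => simp only [map_zero, LinearMap.zero_apply]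
  | add a b ha hb => simp only [map_add, LinearMap.add_apply, ha, hb]
  | tmul a b =>
    rw [map_prodRight_toComplexAlg_kunnethEquiv_tmul, corrMap_kunnethEquiv_tmul_apply, corrMap_kunnethEquiv_tmul_apply, ← map_mul,
      hω.trace_toComplexAlg_apply hω', map_smul, algebraMap_smul]

/-- **`⋀β Θ [T] = [T_ℂ]`**: the complexification of the class of an operator `T : ⋀_ℚ V₁ → ⋀_ℚ V₂` is the class (for `Θ E`) of any
`ℂ`-linear `T_ℂ` with `T_ℂ Θ = Θ T` (`Θ(⋀_ℚ V₁)` spans `⋀_ℂ V₁,ℂ`). [cite: Milne1999LefschetzClasses, §5 p. 664] [cite: BourbakiAlgebraI1989, Ch. III §7 no. 5 Prop. 8] -/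
theorem IsSymplectic.map_prodRight_toComplexAlg_corrEquiv_symm {ω : ExteriorAlgebra ℚ V₁} {g₁ : ℕ} (hω : IsSymplectic ω g₁)
    (hω' : IsSymplectic (toComplexAlg V₁ ω) g₁) {T : ExteriorAlgebra ℚ V₁ →ₗ[ℚ] ExteriorAlgebra ℚ V₂}
    {T' : ExteriorAlgebra ℂ (ℂ ⊗[ℚ] V₁) →ₗ[ℂ] ExteriorAlgebra ℂ (ℂ ⊗[ℚ] V₂)} (hT : ∀ x, T' (toComplexAlg V₁ x) = toComplexAlg V₂ (T x)) :
    ExteriorAlgebra.map (TensorProduct.prodRight ℚ ℂ ℂ V₁ V₂).toLinearMap (toComplexAlg (V₁ × V₂) (hω.corrEquiv.symm T)) =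
      hω'.corrEquiv.symm T' := by
  apply hω'.corrMap_injective
  rw [hω'.corrMap_corrEquiv_symm]
  refine linearMap_ext_of_toComplexAlg fun x ↦ ?_
  rw [hω.corrMap_map_prodRight_toComplexAlg_apply hω', hω.corrMap_corrEquiv_symm, hT]

end ExteriorLefschetz

/-! ## §3 Prop. 5.7, first statement, as printed -/

namespace HodgeStructure

open ExteriorLefschetz ExteriorAlgebra

variable {V₁ V₂ : Type u} [AddCommGroup V₁] [Module ℚ V₁] [Module.Finite ℚ V₁] [AddCommGroup V₂] [Module ℚ V₂] [Module.Finite ℚ V₂]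
  {n : ℤ} {H₁ : HodgeStructure V₁ n} {H₂ : HodgeStructure V₂ n} (Q₁ : Polarization H₁) (Q₂ : Polarization H₂) (hn : Odd n)
  {g₁ g₂ : ℕ} (hg₁ : Module.finrank ℚ V₁ = 2 * g₁) (hg₂ : Module.finrank ℚ V₂ = 2 * g₂)

include hn in
/-- **`x ∈ ℚ[B¹(H)]` iff `Θ x` is fixed by `S(H)(ℂ)`** — the membership form of the tree's Thm. 3.2 / Cor. 4.5
(`Polarization.setOf_forall_lefschetzGroupBaseChange_map_toComplexAlg_eq_eq_adjoin_hodgeClasses_two`): "Lefschetz ⟺ fixed by `L(A)`".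
[cite: Milne1999LefschetzClasses, §3 Thm. 3.2 (p. 653) and §4 Cor. 4.5 (p. 659)] -/
theorem Polarization.mem_adjoin_hodgeClasses_two_iff_forall_map_toComplexAlg_eq (x : ExteriorAlgebra ℚ V₁) :
    x ∈ Algebra.adjoin ℚ (((H₁.exteriorPower 2).hodgeClasses n).map (⋀[ℚ]^2 V₁).subtype : Set (ExteriorAlgebra ℚ V₁)) ↔
      ∀ γ ∈ Q₁.lefschetzGroupBaseChange ℂ,
        ExteriorAlgebra.map (γ : ℂ ⊗[ℚ] V₁ →ₗ[ℂ] ℂ ⊗[ℚ] V₁) (toComplexAlg V₁ x) = toComplexAlg V₁ x := by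
  have h := Q₁.setOf_forall_lefschetzGroupBaseChange_map_toComplexAlg_eq_eq_adjoin_hodgeClasses_two hn
  rw [Set.ext_iff] at h
  exact ((h x).trans Iff.rfl).symm

include hn hg₁ in
/-- **MILNE 1999, PROP. 5.7, FIRST STATEMENT, AS PRINTED: a correspondence `u ∈ H•(A × B) = ⋀(V₁ ⊕ V₂)` is Lefschetz
(`u ∈ ℚ[B¹(H₁ ⊕ H₂)]`) if and only if `ū` commutes with the actions of `L(A × B)`** — i.e. for every `γ₁ ⊕ γ₂ ∈ S(H₁ ⊕ H₂)(ℂ)` (the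
block-diagonal elements subject to the intertwining conditions of Prop. 1.5, acting on `H•(A)_ℂ` by `⋀γ₁` and on `H•(B)_ℂ` by `⋀γ₂`),
`⋀γ₂ ∘ ū_ℂ = ū_ℂ ∘ ⋀γ₁`, `ū_ℂ` the realisation of the complexified class. Proof as printed: "Lefschetz ⟺ fixed by `L(A × B)`"
(Cor. 4.5, the tree's Thm. 3.2 for `Q₁.prod Q₂`), and "the map `u ↦ ū` is bijective and commutes with the action of `L(A × B)`"
(rows g32-#2 `IsSymplectic.map_prodMap_eq_self_iff`, §1 `map_prodRight_map_blockDiag`). [cite: Milne1999LefschetzClasses, §5 Prop. 5.7 (p. 664)]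
[cite: Milne1999LefschetzClasses, §4 Cor. 4.5 (p. 659)] -/
theorem Polarization.mem_adjoin_hodgeClasses_two_prod_iff_forall_blockDiag (u : ExteriorAlgebra ℚ (V₁ × V₂)) :
    u ∈ Algebra.adjoin ℚ ((((H₁.prod H₂).exteriorPower 2).hodgeClasses n).map (⋀[ℚ]^2 (V₁ × V₂)).subtype :
        Set (ExteriorAlgebra ℚ (V₁ × V₂))) ↔
      ∀ (γ₁ : (ℂ ⊗[ℚ] V₁) ≃ₗ[ℂ] (ℂ ⊗[ℚ] V₁)) (γ₂ : (ℂ ⊗[ℚ] V₂) ≃ₗ[ℂ] (ℂ ⊗[ℚ] V₂)),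
        blockDiag ℂ V₁ V₂ (γ₁, γ₂) ∈ (Q₁.prod Q₂).lefschetzGroupBaseChange ℂ →
          (ExteriorAlgebra.map (γ₂ : ℂ ⊗[ℚ] V₂ →ₗ[ℂ] ℂ ⊗[ℚ] V₂)).toLinearMap ∘ₗ
              corrMap (toComplexAlg V₁ (Q₁.lefschetzClass : ExteriorAlgebra ℚ V₁)) g₁
                (ExteriorAlgebra.map (TensorProduct.prodRight ℚ ℂ ℂ V₁ V₂).toLinearMap (toComplexAlg (V₁ × V₂) u)) =
            corrMap (toComplexAlg V₁ (Q₁.lefschetzClass : ExteriorAlgebra ℚ V₁)) g₁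
                (ExteriorAlgebra.map (TensorProduct.prodRight ℚ ℂ ℂ V₁ V₂).toLinearMap (toComplexAlg (V₁ × V₂) u)) ∘ₗ
              (ExteriorAlgebra.map (γ₁ : ℂ ⊗[ℚ] V₁ →ₗ[ℂ] ℂ ⊗[ℚ] V₁)).toLinearMap := by
  rw [(Q₁.prod Q₂).mem_adjoin_hodgeClasses_two_iff_forall_map_toComplexAlg_eq hn]
  have hE := Q₁.isSymplectic_toComplexAlg_lefschetzClass hn hg₁
  constructor
  · intro h γ₁ γ₂ hγ
    have hγ₁ : γ₁ ∈ Q₁.lefschetzGroupBaseChange ℂ := ((Q₁.blockDiag_mem_lefschetzGroupBaseChange_prod_iff Q₂ γ₁ γ₂).1 hγ).1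
    have h2 : ExteriorAlgebra.map ((γ₁ : ℂ ⊗[ℚ] V₁ →ₗ[ℂ] ℂ ⊗[ℚ] V₁).prodMap (γ₂ : ℂ ⊗[ℚ] V₂ →ₗ[ℂ] ℂ ⊗[ℚ] V₂))
        (ExteriorAlgebra.map (TensorProduct.prodRight ℚ ℂ ℂ V₁ V₂).toLinearMap (toComplexAlg (V₁ × V₂) u)) =
          ExteriorAlgebra.map (TensorProduct.prodRight ℚ ℂ ℂ V₁ V₂).toLinearMap (toComplexAlg (V₁ × V₂) u) := by
      rw [← map_prodRight_map_blockDiag, h _ hγ]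
    exact (hE.map_prodMap_eq_self_iff (Q₁.map_toComplexAlg_lefschetzClass_eq_of_mem_lefschetzGroupBaseChange hn hγ₁) _ _).1 h2
  · intro h γ hγ
    obtain ⟨⟨γ₁, γ₂⟩, ⟨hγ₁, -⟩, hγ'⟩ := Polarization.lefschetzGroupBaseChange_prod_le_map_blockDiag ℂ Q₁ Q₂ hγ
    rw [← hγ'] at hγ ⊢
    have h2 := (hE.map_prodMap_eq_self_iff (Q₁.map_toComplexAlg_lefschetzClass_eq_of_mem_lefschetzGroupBaseChange hn hγ₁)
      (γ₂ : ℂ ⊗[ℚ] V₂ →ₗ[ℂ] ℂ ⊗[ℚ] V₂)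
      (ExteriorAlgebra.map (TensorProduct.prodRight ℚ ℂ ℂ V₁ V₂).toLinearMap (toComplexAlg (V₁ × V₂) u))).2 (h γ₁ γ₂ hγ)
    apply map_equiv_injective (TensorProduct.prodRight ℚ ℂ ℂ V₁ V₂)
    rw [map_prodRight_map_blockDiag, h2]

include hn hg₁ in
/-- **PROP. 5.7, FIRST STATEMENT, FOR `A = B`: `u ∈ ℚ[B¹(H ⊕ H)]` iff `ū_ℂ` commutes with `⋀γ` for every `γ ∈ S(H)(ℂ)`** ("`S(A × A) = Δ S(A)`",
the tree's `blockDiag_mem_lefschetzGroupBaseChange_prod_self_iff`). [cite: Milne1999LefschetzClasses, §5 Prop. 5.7 (p. 664) and §3 p. 654 ("S(A) = S(A^r)")] -/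
theorem Polarization.mem_adjoin_hodgeClasses_two_prod_self_iff_forall (u : ExteriorAlgebra ℚ (V₁ × V₁)) :
    u ∈ Algebra.adjoin ℚ ((((H₁.prod H₁).exteriorPower 2).hodgeClasses n).map (⋀[ℚ]^2 (V₁ × V₁)).subtype :
        Set (ExteriorAlgebra ℚ (V₁ × V₁))) ↔
      ∀ γ ∈ Q₁.lefschetzGroupBaseChange ℂ,
        (ExteriorAlgebra.map (γ : ℂ ⊗[ℚ] V₁ →ₗ[ℂ] ℂ ⊗[ℚ] V₁)).toLinearMap ∘ₗ
            corrMap (toComplexAlg V₁ (Q₁.lefschetzClass : ExteriorAlgebra ℚ V₁)) g₁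
              (ExteriorAlgebra.map (TensorProduct.prodRight ℚ ℂ ℂ V₁ V₁).toLinearMap (toComplexAlg (V₁ × V₁) u)) =
          corrMap (toComplexAlg V₁ (Q₁.lefschetzClass : ExteriorAlgebra ℚ V₁)) g₁
              (ExteriorAlgebra.map (TensorProduct.prodRight ℚ ℂ ℂ V₁ V₁).toLinearMap (toComplexAlg (V₁ × V₁) u)) ∘ₗ
            (ExteriorAlgebra.map (γ : ℂ ⊗[ℚ] V₁ →ₗ[ℂ] ℂ ⊗[ℚ] V₁)).toLinearMap := by
  rw [Q₁.mem_adjoin_hodgeClasses_two_prod_iff_forall_blockDiag Q₁ hn hg₁]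
  constructor
  · intro h γ hγ
    exact h γ γ ((Q₁.blockDiag_mem_lefschetzGroupBaseChange_prod_self_iff γ γ).2 ⟨hγ, rfl⟩)
  · intro h γ₁ γ₂ hγ
    obtain ⟨hγ₁, h12⟩ := (Q₁.blockDiag_mem_lefschetzGroupBaseChange_prod_self_iff γ₁ γ₂).1 hγ
    rw [h12]
    exact h γ₁ hγ₁

include hn hg₁ in
/-- **PROP. 5.7 FOR THE CLASS OF AN OPERATOR: `[T] ∈ ℚ[B¹(H₁ ⊕ H₂)]` iff `⋀γ₂ ∘ T_ℂ = T_ℂ ∘ ⋀γ₁` for every `γ₁ ⊕ γ₂ ∈ S(H₁ ⊕ H₂)(ℂ)`**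
(`[T] = corrEquiv⁻¹ T` the correspondence realising `T : ⋀_ℚ V₁ → ⋀_ℚ V₂`, `T_ℂ` any `ℂ`-linear extension: `T_ℂ Θ = Θ T`; §2
`⋀β Θ [T] = [T_ℂ]`). [cite: Milne1999LefschetzClasses, §5 Prop. 5.7 (p. 664)] -/
theorem Polarization.corrEquiv_symm_mem_adjoin_hodgeClasses_two_prod_iff {T : ExteriorAlgebra ℚ V₁ →ₗ[ℚ] ExteriorAlgebra ℚ V₂}
    {T' : ExteriorAlgebra ℂ (ℂ ⊗[ℚ] V₁) →ₗ[ℂ] ExteriorAlgebra ℂ (ℂ ⊗[ℚ] V₂)} (hT : ∀ x, T' (toComplexAlg V₁ x) = toComplexAlg V₂ (T x)) :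
    (Q₁.isSymplectic_lefschetzClass hn hg₁).corrEquiv.symm T ∈
        Algebra.adjoin ℚ ((((H₁.prod H₂).exteriorPower 2).hodgeClasses n).map (⋀[ℚ]^2 (V₁ × V₂)).subtype :
          Set (ExteriorAlgebra ℚ (V₁ × V₂))) ↔
      ∀ (γ₁ : (ℂ ⊗[ℚ] V₁) ≃ₗ[ℂ] (ℂ ⊗[ℚ] V₁)) (γ₂ : (ℂ ⊗[ℚ] V₂) ≃ₗ[ℂ] (ℂ ⊗[ℚ] V₂)),
        blockDiag ℂ V₁ V₂ (γ₁, γ₂) ∈ (Q₁.prod Q₂).lefschetzGroupBaseChange ℂ →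
          (ExteriorAlgebra.map (γ₂ : ℂ ⊗[ℚ] V₂ →ₗ[ℂ] ℂ ⊗[ℚ] V₂)).toLinearMap ∘ₗ T' =
            T' ∘ₗ (ExteriorAlgebra.map (γ₁ : ℂ ⊗[ℚ] V₁ →ₗ[ℂ] ℂ ⊗[ℚ] V₁)).toLinearMap := by
  rw [Q₁.mem_adjoin_hodgeClasses_two_prod_iff_forall_blockDiag Q₂ hn hg₁,
    (Q₁.isSymplectic_lefschetzClass hn hg₁).map_prodRight_toComplexAlg_corrEquiv_symm
      (Q₁.isSymplectic_toComplexAlg_lefschetzClass hn hg₁) hT, IsSymplectic.corrMap_corrEquiv_symm]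

include hn hg₁ in
/-- **The same for `A = B`: `[T] ∈ ℚ[B¹(H ⊕ H)]` iff `T_ℂ` commutes with `⋀γ` for every `γ ∈ S(H)(ℂ)`** — the form in which Thm. 5.9
("`Λ` […] commutes with the action of `L(A)`, which implies […] is therefore Lefschetz") uses Prop. 5.7.
[cite: Milne1999LefschetzClasses, §5 Prop. 5.7 and Thm. 5.9 (pp. 664–665)] -/
theorem Polarization.corrEquiv_symm_mem_adjoin_hodgeClasses_two_prod_self_iff {T : ExteriorAlgebra ℚ V₁ →ₗ[ℚ] ExteriorAlgebra ℚ V₁}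
    {T' : ExteriorAlgebra ℂ (ℂ ⊗[ℚ] V₁) →ₗ[ℂ] ExteriorAlgebra ℂ (ℂ ⊗[ℚ] V₁)} (hT : ∀ x, T' (toComplexAlg V₁ x) = toComplexAlg V₁ (T x)) :
    (Q₁.isSymplectic_lefschetzClass hn hg₁).corrEquiv.symm T ∈
        Algebra.adjoin ℚ ((((H₁.prod H₁).exteriorPower 2).hodgeClasses n).map (⋀[ℚ]^2 (V₁ × V₁)).subtype :
          Set (ExteriorAlgebra ℚ (V₁ × V₁))) ↔
      ∀ γ ∈ Q₁.lefschetzGroupBaseChange ℂ,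
        (ExteriorAlgebra.map (γ : ℂ ⊗[ℚ] V₁ →ₗ[ℂ] ℂ ⊗[ℚ] V₁)).toLinearMap ∘ₗ T' =
          T' ∘ₗ (ExteriorAlgebra.map (γ : ℂ ⊗[ℚ] V₁ →ₗ[ℂ] ℂ ⊗[ℚ] V₁)).toLinearMap := by
  rw [Q₁.mem_adjoin_hodgeClasses_two_prod_self_iff_forall hn hg₁,
    (Q₁.isSymplectic_lefschetzClass hn hg₁).map_prodRight_toComplexAlg_corrEquiv_symm
      (Q₁.isSymplectic_toComplexAlg_lefschetzClass hn hg₁) hT, IsSymplectic.corrMap_corrEquiv_symm]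

/-! ## §4 Prop. 5.7, second statement: a Lefschetz correspondence maps Lefschetz classes to Lefschetz classes -/

include hn hg₁ in
/-- **MILNE 1999, PROP. 5.7, SECOND STATEMENT — "If `u` is Lefschetz, then `ū` maps `D(A)_k` into `D(B)_k`"**: for `u ∈ ℚ[B¹(H₁ ⊕ H₂)]`
and `x ∈ ℚ[B¹(H₁)]`, `ū x ∈ ℚ[B¹(H₂)]` — `Θ(ū x) = ū_ℂ(Θ x)`, and for `γ₂ ∈ S(H₂)(ℂ)` with a lift `γ₁ ⊕ γ₂ ∈ S(H₁ ⊕ H₂)(ℂ)`,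
`⋀γ₂ ū_ℂ Θx = ū_ℂ ⋀γ₁ Θx = ū_ℂ Θx`. The hypothesis `hsurj` is "`L(B)` is a quotient of `L = L(A × B)`" (p. 663) on `ℂ`-points: every
`γ₂ ∈ S(H₂)(ℂ)` lifts to `S(H₁ ⊕ H₂)(ℂ)`; it holds for `A = B` and for Hom-orthogonal pairs (next two statements).
[cite: Milne1999LefschetzClasses, §5 Prop. 5.7 (p. 664) and p. 663] [cite: Milne1999LefschetzClasses, §4 Cor. 4.5 (p. 659)] -/
theorem Polarization.corrMap_apply_mem_adjoin_hodgeClasses_two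
    (hsurj : ∀ γ₂ ∈ Q₂.lefschetzGroupBaseChange ℂ, ∃ γ₁ : (ℂ ⊗[ℚ] V₁) ≃ₗ[ℂ] (ℂ ⊗[ℚ] V₁),
      blockDiag ℂ V₁ V₂ (γ₁, γ₂) ∈ (Q₁.prod Q₂).lefschetzGroupBaseChange ℂ)
    {u : ExteriorAlgebra ℚ (V₁ × V₂)}
    (hu : u ∈ Algebra.adjoin ℚ ((((H₁.prod H₂).exteriorPower 2).hodgeClasses n).map (⋀[ℚ]^2 (V₁ × V₂)).subtype :
      Set (ExteriorAlgebra ℚ (V₁ × V₂))))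
    {x : ExteriorAlgebra ℚ V₁}
    (hx : x ∈ Algebra.adjoin ℚ (((H₁.exteriorPower 2).hodgeClasses n).map (⋀[ℚ]^2 V₁).subtype : Set (ExteriorAlgebra ℚ V₁))) :
    corrMap (Q₁.lefschetzClass : ExteriorAlgebra ℚ V₁) g₁ u x ∈
      Algebra.adjoin ℚ (((H₂.exteriorPower 2).hodgeClasses n).map (⋀[ℚ]^2 V₂).subtype : Set (ExteriorAlgebra ℚ V₂)) := by
  rw [Q₂.mem_adjoin_hodgeClasses_two_iff_forall_map_toComplexAlg_eq hn]
  intro γ₂ hγ₂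
  obtain ⟨γ₁, hγ⟩ := hsurj γ₂ hγ₂
  have hγ₁ : γ₁ ∈ Q₁.lefschetzGroupBaseChange ℂ := ((Q₁.blockDiag_mem_lefschetzGroupBaseChange_prod_iff Q₂ γ₁ γ₂).1 hγ).1
  have hc := (Q₁.mem_adjoin_hodgeClasses_two_prod_iff_forall_blockDiag Q₂ hn hg₁ u).1 hu γ₁ γ₂ hγ
  have hx' := (Q₁.mem_adjoin_hodgeClasses_two_iff_forall_map_toComplexAlg_eq hn x).1 hx γ₁ hγ₁
  have key := LinearMap.congr_fun hc (toComplexAlg V₁ x)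
  simp only [LinearMap.comp_apply, AlgHom.toLinearMap_apply] at key
  rw [hx', (Q₁.isSymplectic_lefschetzClass hn hg₁).corrMap_map_prodRight_toComplexAlg_apply
    (Q₁.isSymplectic_toComplexAlg_lefschetzClass hn hg₁)] at key
  exact key

include hn hg₁ in
/-- **Prop. 5.7, second statement, for `A = B`: a Lefschetz correspondence `u ∈ ℚ[B¹(H ⊕ H)]` maps `ℚ[B¹(H)]` into itself** (every
`γ ∈ S(H)(ℂ)` lifts as `γ ⊕ γ`). [cite: Milne1999LefschetzClasses, §5 Prop. 5.7 (p. 664) and §3 p. 654 ("S(A) = S(A^r)")] -/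
theorem Polarization.corrMap_apply_mem_adjoin_hodgeClasses_two_of_prod_self {u : ExteriorAlgebra ℚ (V₁ × V₁)}
    (hu : u ∈ Algebra.adjoin ℚ ((((H₁.prod H₁).exteriorPower 2).hodgeClasses n).map (⋀[ℚ]^2 (V₁ × V₁)).subtype :
      Set (ExteriorAlgebra ℚ (V₁ × V₁))))
    {x : ExteriorAlgebra ℚ V₁}
    (hx : x ∈ Algebra.adjoin ℚ (((H₁.exteriorPower 2).hodgeClasses n).map (⋀[ℚ]^2 V₁).subtype : Set (ExteriorAlgebra ℚ V₁))) :
    corrMap (Q₁.lefschetzClass : ExteriorAlgebra ℚ V₁) g₁ u x ∈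
      Algebra.adjoin ℚ (((H₁.exteriorPower 2).hodgeClasses n).map (⋀[ℚ]^2 V₁).subtype : Set (ExteriorAlgebra ℚ V₁)) :=
  Q₁.corrMap_apply_mem_adjoin_hodgeClasses_two Q₁ hn hg₁
    (fun γ hγ ↦ ⟨γ, (Q₁.blockDiag_mem_lefschetzGroupBaseChange_prod_self_iff γ γ).2 ⟨hγ, rfl⟩⟩) hu hx

include Q₂ hn hg₁ in
/-- **Prop. 5.7, second statement, for Hom-orthogonal summands** (`Hom(H₁, H₂) = 0 = Hom(H₂, H₁)`, so that `S(H₁ ⊕ H₂)(ℂ) =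
S(H₁)(ℂ) × S(H₂)(ℂ)`, Prop. 1.5; `γ₂` lifts as `1 ⊕ γ₂`). [cite: Milne1999LefschetzClasses, §5 Prop. 5.7 (p. 664) and §1 Prop. 1.5 (p. 644)] -/
theorem Polarization.corrMap_apply_mem_adjoin_hodgeClasses_two_of_hom_eq_zero (hf : ∀ f : Hom H₁ H₂, f.toLinearMap = 0)
    (hg : ∀ g : Hom H₂ H₁, g.toLinearMap = 0) {u : ExteriorAlgebra ℚ (V₁ × V₂)}
    (hu : u ∈ Algebra.adjoin ℚ ((((H₁.prod H₂).exteriorPower 2).hodgeClasses n).map (⋀[ℚ]^2 (V₁ × V₂)).subtype :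
      Set (ExteriorAlgebra ℚ (V₁ × V₂))))
    {x : ExteriorAlgebra ℚ V₁}
    (hx : x ∈ Algebra.adjoin ℚ (((H₁.exteriorPower 2).hodgeClasses n).map (⋀[ℚ]^2 V₁).subtype : Set (ExteriorAlgebra ℚ V₁))) :
    corrMap (Q₁.lefschetzClass : ExteriorAlgebra ℚ V₁) g₁ u x ∈
      Algebra.adjoin ℚ (((H₂.exteriorPower 2).hodgeClasses n).map (⋀[ℚ]^2 V₂).subtype : Set (ExteriorAlgebra ℚ V₂)) :=
  Q₁.corrMap_apply_mem_adjoin_hodgeClasses_two Q₂ hn hg₁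
    (fun γ₂ hγ₂ ↦ ⟨1, (Q₁.forall_blockDiag_mem_lefschetzGroupBaseChange_prod_iff ℂ Q₂).2 ⟨hf, hg⟩ 1 (Subgroup.one_mem _) γ₂ hγ₂⟩)
    hu hx

end HodgeStructure

end Literature.AlgebraicGeometry.Motives
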